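import Summits.AtomisticToContinuum.HydrodynamicLimit.Theorems.ImplosionDichotomyPolynomialCompressionShadowInterpolation
import Summits.AtomisticToContinuum.HydrodynamicLimit.Theorems.ImplosionDichotomyPolynomialCompressionShadowingDefs

/-!
# Interpolation of the level-1 and level-2 shadowing energies (line `log-lipschitz-budget`, stub 4)

Helper file for the crux `ImplosionDichotomy.PolynomialCompression` (stmt-AtomisticToContinuum-12587), stub
`stub_logBudgetShadowing`. Weighted form of `shadow_interpolation`: at a time `s` at which `ζ` is smooth on an
open set containing the densities `ρ(s, ·)` and the three weights `A, ρ, B` of the level energies lie in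
`[m, M]`, `E₁ ≤ √3 (M/m) √(E₀ E₂)` and `E₂ ≤ √3 (M/m) √(E₁ E₃)` (`Eₖ = shadowEk …`): compare with the
unweighted integrals, apply `shadow_interpolation` componentwise, and recombine with Cauchy–Schwarz over the
components. This replaces the level-1 and level-2 energy estimates of the blueprint: the close solves the
resulting algebraic constraints for the level constants. (The smoothness of `ζ` near the density range makes
the weight `A = θ(ζ(ρ) + ρζ'(ρ))/ρ` continuous, so that all level integrands are integrable; for an arbitrary
`ζ` the weighted energies are not comparable.)
-/

noncomputable section

namespace Summit.AtomisticToContinuum.HydrodynamicLimit.Theorems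

open Set MeasureTheory
open Literature.MathematicalPhysics.KineticTheory Literature.Analysis.FunctionSpaces

/-- Weighted versus unweighted level integrands: for continuous weights `wA, wρ, wB` with values in
`[m, M]` and continuous families `a_i, b_i, c_i` on `𝕋³`,
`m/2 · (Σᵢ∫aᵢ² + Σᵢ∫‖bᵢ‖² + Σᵢ∫cᵢ²) ≤ ∫ Σᵢ ½(wA aᵢ² + wρ ‖bᵢ‖² + wB cᵢ²) ≤ M/2 · (…)`. [folklore] -/
private theorem il_level_compare {ι : Type*} [Fintype ι] {wA wρ wB : T3 → ℝ} {a c : ι → T3 → ℝ}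
    {b : ι → T3 → V3} {m M : ℝ}
    (hwA : Continuous wA) (hwρ : Continuous wρ) (hwB : Continuous wB)
    (ha : ∀ i, Continuous (a i)) (hb : ∀ i, Continuous (b i)) (hc : ∀ i, Continuous (c i))
    (hw : ∀ x, m ≤ wA x ∧ wA x ≤ M ∧ m ≤ wρ x ∧ wρ x ≤ M ∧ m ≤ wB x ∧ wB x ≤ M) :
    m / 2 * ((∑ i, ∫ x, a i x ^ 2) + (∑ i, ∫ x, ‖b i x‖ ^ 2) + ∑ i, ∫ x, c i x ^ 2) ≤
        ∫ x, ∑ i, 1 / 2 * (wA x * a i x ^ 2 + wρ x * ‖b i x‖ ^ 2 + wB x * c i x ^ 2) ∧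
      ∫ x, ∑ i, 1 / 2 * (wA x * a i x ^ 2 + wρ x * ‖b i x‖ ^ 2 + wB x * c i x ^ 2) ≤
        M / 2 * ((∑ i, ∫ x, a i x ^ 2) + (∑ i, ∫ x, ‖b i x‖ ^ 2) + ∑ i, ∫ x, c i x ^ 2) := by
  -- continuity (hence integrability) of all integrands
  have hia : ∀ i, Continuous fun x => a i x ^ 2 := fun i => (ha i).fun_pow 2
  have hib : ∀ i, Continuous fun x => ‖b i x‖ ^ 2 := fun i => (hb i).norm.fun_pow 2
  have hic : ∀ i, Continuous fun x => c i x ^ 2 := fun i => (hc i).fun_pow 2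
  have hU : Continuous fun x => ∑ i, (a i x ^ 2 + ‖b i x‖ ^ 2 + c i x ^ 2) :=
    continuous_finsetSum _ fun i _ => ((hia i).fun_add (hib i)).fun_add (hic i)
  have hW : Continuous fun x => ∑ i, 1 / 2 * (wA x * a i x ^ 2 + wρ x * ‖b i x‖ ^ 2 + wB x * c i x ^ 2) :=
    continuous_finsetSum _ fun i _ => continuous_const.fun_mul
      (((hwA.fun_mul (hia i)).fun_add (hwρ.fun_mul (hib i))).fun_add (hwB.fun_mul (hic i)))
  -- the unweighted integral splits
  have hsplit : ∫ x, ∑ i, (a i x ^ 2 + ‖b i x‖ ^ 2 + c i x ^ 2) =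
      (∑ i, ∫ x, a i x ^ 2) + (∑ i, ∫ x, ‖b i x‖ ^ 2) + ∑ i, ∫ x, c i x ^ 2 := by
    calc ∫ x, ∑ i, (a i x ^ 2 + ‖b i x‖ ^ 2 + c i x ^ 2)
        = ∑ i, ∫ x, (a i x ^ 2 + ‖b i x‖ ^ 2 + c i x ^ 2) :=
          integral_finsetSum _ fun i _ => (((hia i).fun_add (hib i)).fun_add (hic i)).integrable_unitAddTorus
      _ = ∑ i, ((∫ x, a i x ^ 2) + (∫ x, ‖b i x‖ ^ 2) + ∫ x, c i x ^ 2) := by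
          refine Finset.sum_congr rfl fun i _ => ?_
          rw [integral_add ((hia i).fun_add (hib i)).integrable_unitAddTorus (hic i).integrable_unitAddTorus,
            integral_add (hia i).integrable_unitAddTorus (hib i).integrable_unitAddTorus]
      _ = _ := by rw [Finset.sum_add_distrib, Finset.sum_add_distrib]
  -- pointwise comparison
  have hpt : ∀ x, m / 2 * ∑ i, (a i x ^ 2 + ‖b i x‖ ^ 2 + c i x ^ 2) ≤
        ∑ i, 1 / 2 * (wA x * a i x ^ 2 + wρ x * ‖b i x‖ ^ 2 + wB x * c i x ^ 2) ∧
      ∑ i, 1 / 2 * (wA x * a i x ^ 2 + wρ x * ‖b i x‖ ^ 2 + wB x * c i x ^ 2) ≤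
        M / 2 * ∑ i, (a i x ^ 2 + ‖b i x‖ ^ 2 + c i x ^ 2) := by
    intro x
    obtain ⟨h1, h2, h3, h4, h5, h6⟩ := hw x
    rw [Finset.mul_sum, Finset.mul_sum]
    refine ⟨Finset.sum_le_sum fun i _ => ?_, Finset.sum_le_sum fun i _ => ?_⟩
    · have e1 := mul_le_mul_of_nonneg_right h1 (sq_nonneg (a i x))
      have e2 := mul_le_mul_of_nonneg_right h3 (sq_nonneg ‖b i x‖)
      have e3 := mul_le_mul_of_nonneg_right h5 (sq_nonneg (c i x))
      linarith
    · have e1 := mul_le_mul_of_nonneg_right h2 (sq_nonneg (a i x))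
      have e2 := mul_le_mul_of_nonneg_right h4 (sq_nonneg ‖b i x‖)
      have e3 := mul_le_mul_of_nonneg_right h6 (sq_nonneg (c i x))
      linarith
  rw [← hsplit, ← integral_const_mul, ← integral_const_mul]
  exact ⟨integral_mono (hU.integrable_unitAddTorus.const_mul _) hW.integrable_unitAddTorus fun x => (hpt x).1,
    integral_mono hW.integrable_unitAddTorus (hU.integrable_unitAddTorus.const_mul _) fun x => (hpt x).2⟩

/-- `il_level_compare` for a single multi-index (level `0`). [folklore] -/
private theorem il_level_compare₀ {wA wρ wB a c : T3 → ℝ} {b : T3 → V3} {m M : ℝ}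
    (hwA : Continuous wA) (hwρ : Continuous wρ) (hwB : Continuous wB)
    (ha : Continuous a) (hb : Continuous b) (hc : Continuous c)
    (hw : ∀ x, m ≤ wA x ∧ wA x ≤ M ∧ m ≤ wρ x ∧ wρ x ≤ M ∧ m ≤ wB x ∧ wB x ≤ M) :
    m / 2 * ((∫ x, a x ^ 2) + (∫ x, ‖b x‖ ^ 2) + ∫ x, c x ^ 2) ≤
        ∫ x, 1 / 2 * (wA x * a x ^ 2 + wρ x * ‖b x‖ ^ 2 + wB x * c x ^ 2) ∧
      ∫ x, 1 / 2 * (wA x * a x ^ 2 + wρ x * ‖b x‖ ^ 2 + wB x * c x ^ 2) ≤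
        M / 2 * ((∫ x, a x ^ 2) + (∫ x, ‖b x‖ ^ 2) + ∫ x, c x ^ 2) := by
  have h := il_level_compare (ι := Unit) (a := fun _ => a) (b := fun _ => b) (c := fun _ => c)
    hwA hwρ hwB (fun _ => ha) (fun _ => hb) (fun _ => hc) hw
  simpa using h

/-- The algebra of one interpolation step: from `E₁ ≤ M/2 (p₁ + q₁ + r₁)`, `m/2 (p₀ + q₀ + r₀) ≤ E₀`,
`m/2 (p₂ + q₂ + r₂) ≤ E₂` and the componentwise interpolations `p₁ ≤ √p₀ √(3p₂)` (etc.),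
`E₁ ≤ √3 (M/m) √E₀ √E₂` (Cauchy–Schwarz over the three components). [folklore] -/
private theorem il_alg {m M E₀ E₁ E₂ p₀ p₁ p₂ q₀ q₁ q₂ r₀ r₁ r₂ : ℝ} (hm : 0 < m) (hM : 0 ≤ M)
    (hE₁ : E₁ ≤ M / 2 * (p₁ + q₁ + r₁)) (hE₀ : m / 2 * (p₀ + q₀ + r₀) ≤ E₀)
    (hE₂ : m / 2 * (p₂ + q₂ + r₂) ≤ E₂)
    (hp : p₁ ≤ Real.sqrt p₀ * Real.sqrt (3 * p₂)) (hq : q₁ ≤ Real.sqrt q₀ * Real.sqrt (3 * q₂))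
    (hr : r₁ ≤ Real.sqrt r₀ * Real.sqrt (3 * r₂))
    (hp₀ : 0 ≤ p₀) (hq₀ : 0 ≤ q₀) (hr₀ : 0 ≤ r₀) (hp₂ : 0 ≤ p₂) (hq₂ : 0 ≤ q₂) (hr₂ : 0 ≤ r₂) :
    E₁ ≤ Real.sqrt 3 * (M / m) * Real.sqrt E₀ * Real.sqrt E₂ := by
  -- Cauchy–Schwarz over the three components
  have hcs : Real.sqrt p₀ * Real.sqrt (3 * p₂) + Real.sqrt q₀ * Real.sqrt (3 * q₂) +
      Real.sqrt r₀ * Real.sqrt (3 * r₂) ≤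
      Real.sqrt (p₀ + q₀ + r₀) * Real.sqrt (3 * p₂ + 3 * q₂ + 3 * r₂) := by
    have h := Real.sum_sqrt_mul_sqrt_le Finset.univ (f := ![p₀, q₀, r₀])
      (g := ![3 * p₂, 3 * q₂, 3 * r₂])
      (fun i => by fin_cases i <;> simp <;> linarith) (fun i => by fin_cases i <;> simp <;> linarith)
    simpa [Fin.sum_univ_three] using h
  have h2m : 0 ≤ 2 / m := by positivity
  have hS₀ : p₀ + q₀ + r₀ ≤ 2 / m * E₀ := by
    rw [div_mul_eq_mul_div, le_div_iff₀ hm]; linarith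
  have hS₂ : 3 * p₂ + 3 * q₂ + 3 * r₂ ≤ 3 * (2 / m * E₂) := by
    have : p₂ + q₂ + r₂ ≤ 2 / m * E₂ := by rw [div_mul_eq_mul_div, le_div_iff₀ hm]; linarith
    linarith
  have hk : Real.sqrt (p₀ + q₀ + r₀) * Real.sqrt (3 * p₂ + 3 * q₂ + 3 * r₂) ≤
      (Real.sqrt (2 / m) * Real.sqrt E₀) * (Real.sqrt 3 * (Real.sqrt (2 / m) * Real.sqrt E₂)) := by
    refine mul_le_mul ?_ ?_ (Real.sqrt_nonneg _) (by positivity)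
    · rw [← Real.sqrt_mul h2m]
      exact Real.sqrt_le_sqrt hS₀
    · rw [← Real.sqrt_mul h2m, ← Real.sqrt_mul (by norm_num : (0 : ℝ) ≤ 3)]
      exact Real.sqrt_le_sqrt hS₂
  have hsq : Real.sqrt (2 / m) * Real.sqrt (2 / m) = 2 / m := Real.mul_self_sqrt h2m
  calc E₁ ≤ M / 2 * (p₁ + q₁ + r₁) := hE₁
    _ ≤ M / 2 * ((Real.sqrt (2 / m) * Real.sqrt E₀) *
          (Real.sqrt 3 * (Real.sqrt (2 / m) * Real.sqrt E₂))) :=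
        mul_le_mul_of_nonneg_left ((add_le_add (add_le_add hp hq) hr).trans (hcs.trans hk))
          (by positivity)
    _ = M / 2 * (Real.sqrt (2 / m) * Real.sqrt (2 / m)) * Real.sqrt 3 * Real.sqrt E₀ * Real.sqrt E₂ := by
        ring
    _ = Real.sqrt 3 * (M / m) * Real.sqrt E₀ * Real.sqrt E₂ := by rw [hsq]; ring

/-- **Interpolation of the shadowing energies between levels.** At a time `s ∈ [0, T)` at which
`ζ` is smooth on an open set containing the densities and the three weights `A = shadowWeightA`,
`ρ`, `B = shadowWeightB` of the level energies lie in `[m, M]` (`0 < m`):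
`E₁ ≤ √3 (M/m) √E₀ √E₂` and `E₂ ≤ √3 (M/m) √E₁ √E₃` (`Eₖ = shadowEk …`; compare with the
unweighted energies, `shadow_interpolation` componentwise, Cauchy–Schwarz over the components).
[folklore] -/
theorem shadow_interpolation_levels :
    ∀ {σ σ₁ T : ℝ} {ρ θ ρ₁ θ₁ : ℝ → T3 → ℝ} {u u₁ : ℝ → T3 → V3} {ζ : ℝ → ℝ} {s m M : ℝ} {J : Set ℝ},
      IsHardSphereEulerSolution σ T ρ u θ → IsHardSphereEulerSolution σ₁ T ρ₁ u₁ θ₁ → s ∈ Ico 0 T →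
      IsOpen J → ContDiffOn ℝ (⊤ : ℕ∞) ζ J → (∀ x, ρ s x ∈ J) →
      0 < m → (∀ x, m ≤ shadowWeightA ζ ρ θ s x ∧ shadowWeightA ζ ρ θ s x ≤ M ∧ m ≤ ρ s x ∧ ρ s x ≤ M ∧
        m ≤ shadowWeightB ρ θ s x ∧ shadowWeightB ρ θ s x ≤ M) →
      shadowE1 ζ ρ θ u ρ₁ θ₁ u₁ s ≤
          Real.sqrt 3 * (M / m) * Real.sqrt (shadowE0 ζ ρ θ u ρ₁ θ₁ u₁ s) * Real.sqrt (shadowE2 ζ ρ θ u ρ₁ θ₁ u₁ s) ∧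
        shadowE2 ζ ρ θ u ρ₁ θ₁ u₁ s ≤
          Real.sqrt 3 * (M / m) * Real.sqrt (shadowE1 ζ ρ θ u ρ₁ θ₁ u₁ s) * Real.sqrt (shadowE3 ζ ρ θ u ρ₁ θ₁ u₁ s) := by
  intro σ σ₁ T ρ θ ρ₁ θ₁ u u₁ ζ s m M J hE hE₁ hs hJ hζ hρJ hm hw
  -- smooth slices, the differences and their derivatives
  have hρs : Torus.IsSmooth (ρ s) := hE.smooth_density.isSmooth_slice hs
  have hθs : Torus.IsSmooth (θ s) := hE.smooth_temperature.isSmooth_slice hs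
  have hf₁ : Torus.IsSmooth (fun y => ρ s y - ρ₁ s y) :=
    hρs.sub (hE₁.smooth_density.isSmooth_slice hs)
  have hf₂ : Torus.IsSmooth (fun y => u s y - u₁ s y) :=
    (hE.smooth_velocity.isSmooth_slice hs).sub (hE₁.smooth_velocity.isSmooth_slice hs)
  have hf₃ : Torus.IsSmooth (fun y => θ s y - θ₁ s y) :=
    hθs.sub (hE₁.smooth_temperature.isSmooth_slice hs)
  -- continuity of the weights
  have hζc : Continuous fun x => ζ (ρ s x) := hζ.continuousOn.comp_continuous hρs.continuous hρJ
  have hζ'c : Continuous fun x => deriv ζ (ρ s x) :=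
    (hζ.continuousOn_deriv_of_isOpen hJ (by exact_mod_cast le_top)).comp_continuous hρs.continuous hρJ
  have hcA : Continuous (shadowWeightA ζ ρ θ s) :=
    (hθs.continuous.fun_mul (hζc.fun_add (hρs.continuous.fun_mul hζ'c))).div₀ hρs.continuous
      fun x => (hE.density_pos s hs x).ne'
  have hcB : Continuous (shadowWeightB ρ θ s) :=
    (continuous_const.fun_mul hρs.continuous).div₀ hθs.continuous
      fun x => (hE.temperature_pos s hs x).ne'
  -- the four comparisons
  have h0 := il_level_compare₀ (a := fun y => ρ s y - ρ₁ s y) (b := fun y => u s y - u₁ s y)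
    (c := fun y => θ s y - θ₁ s y) hcA hρs.continuous hcB hf₁.continuous hf₂.continuous hf₃.continuous hw
  have h1 := il_level_compare (ι := Fin 3)
    (a := fun l => Torus.partialDeriv l (fun y => ρ s y - ρ₁ s y))
    (b := fun l => Torus.partialDeriv l (fun y => u s y - u₁ s y))
    (c := fun l => Torus.partialDeriv l (fun y => θ s y - θ₁ s y)) hcA hρs.continuous hcB
    (fun l => (hf₁.partialDeriv l).continuous) (fun l => (hf₂.partialDeriv l).continuous)
    (fun l => (hf₃.partialDeriv l).continuous) hw
  have h2 := il_level_compare (ι := Fin 3 × Fin 3)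
    (a := fun p => Torus.partialDeriv p.1 (Torus.partialDeriv p.2 (fun y => ρ s y - ρ₁ s y)))
    (b := fun p => Torus.partialDeriv p.1 (Torus.partialDeriv p.2 (fun y => u s y - u₁ s y)))
    (c := fun p => Torus.partialDeriv p.1 (Torus.partialDeriv p.2 (fun y => θ s y - θ₁ s y)))
    hcA hρs.continuous hcB
    (fun p => ((hf₁.partialDeriv p.2).partialDeriv p.1).continuous)
    (fun p => ((hf₂.partialDeriv p.2).partialDeriv p.1).continuous)
    (fun p => ((hf₃.partialDeriv p.2).partialDeriv p.1).continuous) hw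
  have h3 := il_level_compare (ι := Fin 3 × Fin 3 × Fin 3)
    (a := fun p => Torus.partialDeriv p.1 (Torus.partialDeriv p.2.1
      (Torus.partialDeriv p.2.2 (fun y => ρ s y - ρ₁ s y))))
    (b := fun p => Torus.partialDeriv p.1 (Torus.partialDeriv p.2.1
      (Torus.partialDeriv p.2.2 (fun y => u s y - u₁ s y))))
    (c := fun p => Torus.partialDeriv p.1 (Torus.partialDeriv p.2.1
      (Torus.partialDeriv p.2.2 (fun y => θ s y - θ₁ s y))))
    hcA hρs.continuous hcB
    (fun p => (((hf₁.partialDeriv p.2.2).partialDeriv p.2.1).partialDeriv p.1).continuous)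
    (fun p => (((hf₂.partialDeriv p.2.2).partialDeriv p.2.1).partialDeriv p.1).continuous)
    (fun p => (((hf₃.partialDeriv p.2.2).partialDeriv p.2.1).partialDeriv p.1).continuous) hw
  simp only [Fintype.sum_prod_type] at h2 h3
  have hM : 0 ≤ M := (hm.le.trans (hw 0).2.2.1).trans (hw 0).2.2.2.1
  have hI := shadow_interpolation
  refine ⟨il_alg hm hM h1.2 h0.1 h2.1 (hI.1 hf₁) (hI.2.2.1 hf₂) (hI.1 hf₃)
      (integral_nonneg fun x => sq_nonneg _) (integral_nonneg fun x => sq_nonneg _)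
      (integral_nonneg fun x => sq_nonneg _) ?_ ?_ ?_,
    il_alg hm hM h2.2 h1.1 h3.1 (hI.2.1 hf₁) (hI.2.2.2 hf₂) (hI.2.1 hf₃) ?_ ?_ ?_ ?_ ?_ ?_⟩
  all_goals positivity

end Summit.AtomisticToContinuum.HydrodynamicLimit.Theorems

end
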